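import Literature.InformationTheory.QuantumLearning.PauliTwirling
import Literature.Computability.QuantumComplexity.DecisionDiagrams
import HarnessLib

/-!
# The sparse Pauli–Lindblad noise model: fidelities, inversion by negation, sampling overhead, gain

Topic `Literature/InformationTheory/QuantumLearning` (pub-qadeq lane), sequel of `PauliTwirling.lean`
(why the noise is a Pauli channel) and `PauliChannelEstimation.lean` (`pauliChannel`, eigenvalues).
The error-MITIGATED expectation values of the IBM-processor rows rest on one parametric noise model
and three sentences about it: CLAIMS E-17 (Kim et al., Nature 618, 500 (2023), p. 3: "The sparse
Pauli–Lindblad noise model proposed in ref. 1 turns out to be especially well suited for noise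
shaping in ZNE … applying `Λ^α` before the noisy layer produces an overall noise channel `Λ^G` with
gain `G = α + 1`. Given the exponential form of the Pauli–Lindblad noise model, the map `e^{Lα}` is
obtained by simply multiplying the Pauli rates `λ_i` by `α`. … for `α ≥ 0`, the map is a Pauli
channel that can be sampled directly, whereas for `α < 0`, quasi-probabilistic sampling is needed
with sampling overhead `γ^{−2α}` for some model-specific `γ`. In PEC, we choose `α = −1` to obtain an
overall zero-gain noise level. In ZNE, we instead amplify the noise"), E-44 / E-46 (probabilistic
error cancellation rows: the "sampling overhead `γ`" of their cost cells), and ref. 1 of E-17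
itself, van den Berg–Minev–Kandala–Temme, Nat. Phys. 19, 1116 (2023).

HONEST FRAMING: instance-level adjudication of specific advantage claims; no claim about BQP vs BPP
or the summit.  Exact finite identities about a parametric family of maps; nothing here says that
any device's noise IS of this form, how well a learned model fits, or what any experiment's `γ` was.

## Sources (verbatim)

[vandenBergMinevKandalaTemme2023] E. van den Berg, Z. K. Minev, A. Kandala, K. Temme,
*Probabilistic error cancellation with sparse Pauli–Lindblad models on noisy quantum processors*,
Nat. Phys. 19, 1116–1121 (2023) = arXiv:2201.09866 (held PDF; main text pp. 1–4, SI pp. 10–12).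
Main text, ¶"Pauli-Lindblad noise model": "We model a given `n`-qubit Pauli noise channel `Λ` that
arises from a sparse set of local interactions, according to a Lindblad Master equation with
generator `L(ρ) = Σ_{k∈𝒦} λ_k (P_k ρ P_k† − ρ)`, where `𝒦` represents a set of local Paulis `P_k`
and `λ_k` denotes the corresponding model coefficient. The resulting model is then given by
`Λ(ρ) = exp[L](ρ) = Π_{k∈𝒦} (w_k · + (1 − w_k) P_k · P_k†) ρ` (1), where `w_k = 2⁻¹(1 + e^{−2λ_k})`.
… The fidelity of a Pauli matrix `P_b` with respect to `Λ` is given by `f_b = (1/2ⁿ) Tr(P_b† Λ(P_b))`.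
Defining the symplectic inner product `⟨b,k⟩_sp` to be `0` if Paulis `P_b` and `P_k` commute and `1`
otherwise, we can concisely express the relationship between model coefficients `λ` and the vector
`f` … as `log(f) = −2M(B,K)λ`, where … `M_{b,k} = ⟨b,k⟩_sp`" (2).  P. 3: "The protocol implements
the channel inverse `Λ_i⁻¹` through quasi-probabilistic sampling for each of the `l` layers. The
inverse of the map `Λ` is obtained by negating `L`, leading to a non-physical map given by
`Λ⁻¹(ρ) = exp[−L](ρ) = γ Π_{k∈𝒦} (w_k · − (1 − w_k) P_k · P_k†) ρ` (3), with sampling overhead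
`γ = exp(Σ_{k∈𝒦} 2λ_k)`. This amounts exactly to inverting each individual factor in Eq. (1) due to
commutativity of the factors. The product structure allows for a direct way of sampling the map.
For each `k ∈ 𝒦` we sample the identity with probability `w_k` or apply the Pauli `P_k` otherwise.
We record the number of times `m` we have applied a non-identity Pauli … The measurement outcome …
is then multiplied by `Π_{i=1}^{l} (−1)^{m_i} γ_i`. On average, this implements the inverse maps and
produces an unbiased expectation value with sampling overhead `γ(l) = Π_i γ_i`."  SI §SIII,
eqs. (S4)–(S11): "`L(ρ) = Σ_{k∈𝒦} λ_k (P_k ρ P_k − ρ)` (S4) … Note that for any two Pauli operators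
`P` and `Q` it holds that `(P⊗Pᵀ)(Q⊗Qᵀ) = … = (Q⊗Qᵀ)(P⊗Pᵀ)`. This shows that the terms in (S6)
commute, and also expresses the fact that Pauli channels commute. … `e^{λ(P⊗Pᵀ)} = cosh(λ)(I⊗I) +
sinh(λ)(P⊗Pᵀ)` (S8) … `Λ(ρ) = Π_k (w_k · + (1 − w_k) P_k · P_k†) ρ` (S9), where
`w_k = (1 + e^{−2λ_k})/2`. … `f_a = (1/2ⁿ) Tr[P_a† Λ(P_a)] = … = Π_{⟨a,k⟩_sp=1} (2w_k − 1) =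
Π_{⟨a,k⟩_sp=1} e^{−2λ_k} = exp(−2 Σ_{k∈𝒦} λ_k ⟨a,k⟩_sp)` (S10) … `−log(f)/2 = Mλ` (S11) … we observe
that the coefficients `w_k` in (S9) are all nonnegative, and that the fidelity for the identity
operator is always one, since all Pauli terms commute with the identity. It follows that (S9) is a
valid Pauli channel for all `λ ≥ 0`."  SI §SIII A "Channel operations": "First, changing the
evolution time amounts to scaling `λ`. Second, given two separate noise channels with parameters
`λ₁` and `λ₂`, it follows from multiplicativity of fidelities under successive Pauli channels that
`−log(f₁f₂)/2 = −log(f₁)/2 − log(f₂)/2 = Mλ₁ + Mλ₂ = M(λ₁ + λ₂)`, which shows that combination of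
channels amounts to addition of the coefficients. The inverse of a channel is characterized by
inverse fidelities, and it directly follows from `−log(1/f)/2 = log(f)/2 = −Mλ = M(−λ)` that the
inverse noise model is obtained by simply negating the coefficients."  SI §SII B: "`T_Λ⁻¹ =
diag(f_a⁻¹)` … `γ := Σ_i |c_i^inv|` … The cost of sampling from the quasi-probabilistic distribution
is an increase in variance in the expected value by a factor of `O(γ²)`."

[KimEtAl2023] Y. Kim et al., *Evidence for the utility of quantum computing before fault tolerance*,
Nature 618, 500 (2023), main text p. 3 (quoted above) and Methods ¶"Noise model": "a general Pauli
channel is approximated by `Λ(ρ) = exp[L](ρ)` with a sparse Pauli–Lindblad generator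
`L(ρ) = Σ_i λ_i (P_i ρ P_i† − ρ)`. Here the jump operators are chosen to be Pauli operators `P_i`
with `P_i P_i† = I` and the model is parameterized by the non-negative coefficients `λ_i`. This model
can be rewritten as `Λ(ρ) = ◯_i (w_i · + (1 − w_i) P_i · P_i†)(ρ)`, in which
`w_i = (1 + e^{−2λ_i})/2`".

## Dictionary and contents (all proved, 0 named facts)

A model is a LIST `L` of pairs `(P_k, μ_k)` (Pauli string, real rate); `λ ≥ 0` is the noise model,
negative rates appear for its inverse / attenuation.  `⟨a,k⟩_sp` is read off the tree's commutation
sign `strSign k a ∈ {1, −1}`.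

* `conjBy k ρ = P_k ρ P_k` and its algebra (`conjBy_conjBy`, `conjBy_comm` — "Pauli channels
  commute", `conjBy_pauliString`, `conjBy_conjBy_eq`); `weight μ = (1 + e^{−2μ})/2`
  (`two_mul_weight_sub_one`: `2w − 1 = e^{−2μ}`); `factor k μ = w · + (1 − w) P_k · P_k` (one factor of
  (1)/(S9)); `channel L = Π factors` (eq. (1)).
* **`factor_pauliString`** / **`channel_pauliString`** + `fidelity`, **`fidelity_eq_exp`** (S10),
  **`neg_log_fidelity_div_two`** (S11), `fidelity_eq_trace` (the printed `f_a = 2^{−n} Tr(P_a†Λ(P_a))`),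
  `fidelity_const_I`, `fidelity_le_one` / `fidelity_pos`, `trace_channel` (TP).
* §SIII A "Channel operations": **`factor_comp`** (same Pauli: rates ADD), `factor_comm`,
  `fidelity_append` / `exponent_append` (successive channels multiply fidelities / add coefficients),
  `exponent_scaleRates` ("changing the evolution time amounts to scaling λ"), **`fidelity_scaleRates`**
  (Kim et al.'s PEA: rates `αλ` ⇒ fidelities `f_a^α`), **`fidelity_scaleRates_append`** (gain
  `G = α + 1`), `fidelity_negRates` (inverse fidelities).
* Eq. (3): **`factor_neg_eq`** (the printed inverse factor `γ_k (w_k · − (1 − w_k) P_k·P_k†)` IS the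
  factor with rate `−λ_k`, `γ_k = e^{2λ_k}`), `factor_neg_comp`, **`channel_negRates_channel`** /
  `channel_channel_negRates` (`Λ_{−λ} ∘ Λ_λ = id = Λ_λ ∘ Λ_{−λ}`).
* Sampling overhead: `factorCost μ = |w| + |1 − w|` (`= 1` for `μ ≥ 0`, `= e^{−2μ}` for `μ ≤ 0`),
  `cost L = Π factorCost`; **`cost_negRates`** (`γ = exp(Σ_k 2λ_k)`, eq. (3)), **`cost_scaleRates`**
  (Kim et al.'s `γ^{−2α}` with `γ = exp(Σλ)`, `α ≤ 0`), `cost_of_nonneg` (`α ≥ 0`: a samplable Pauli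
  channel, no overhead).
* "(S9) is a valid Pauli channel for all `λ ≥ 0`": `factor_eq_pauliChannel` (+ `factorRates_nonneg`,
  `sum_factorRates`), the composition law **`pauliChannel_comp`** (`Λ_p ∘ Λ_q = Λ_{p⋆q}`, convolution
  over the Pauli group modulo phases; `sandwich_mul_eq`, `star_stringPhase_mul`), and by induction
  **`channel_eq_pauliChannel`** with **`rates_nonneg`** (for `λ ≥ 0`) and `sum_rates`.

## Not here

Learning the model (the nonnegative least squares of SI §SIII C, cycle benchmarking, SPAM), the
choice of `𝒦` and its size `3n + 9(n−1)` for a line, the error bound of SI §SVI.2, the variance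
statement "`O(γ²)`" as a theorem about an estimator, zero-noise EXTRAPOLATION itself (the fit in `G`),
twirling (see `PauliTwirling.lean`), and any statement about a device.  Searched
`lean search 'Lindblad|quasiProb|PEC|pauliChannel_comp'`: no Pauli–Lindblad model, channel inverse or
composition law for `pauliChannel` in the tree before this file (`PauliTwirling.lean` has only the
action of a composite on Pauli strings, `pauliChannel_pauliChannel_pauliString`).
-/

noncomputable section

open Matrix Finset

namespace Literature.InformationTheory.QuantumLearning.SparsePauliLindblad

open Literature.Computability.QuantumComplexity
open Literature.Computability.QuantumComplexity.PauliPath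
open Literature.Computability.QuantumComplexity.OTOC
open Literature.InformationTheory.QuantumLearning.PauliChannelEstimation

variable {ι : Type*} [Fintype ι] [DecidableEq ι]

/-- Conjugation by a Pauli string, `ρ ↦ P_k ρ P_k†` (`= P_k ρ P_k`, the tree's Pauli strings being
Hermitian) — the jump term of the generator `L(ρ) = Σ_k λ_k (P_k ρ P_k† − ρ)`.
[cite: vandenBergMinevKandalaTemme2023, main text ¶"Pauli-Lindblad noise model" and SI eq. (S4)] -/
def conjBy (k : ι → Pauli) (ρ : Matrix (ι → Bool) (ι → Bool) ℂ) : Matrix (ι → Bool) (ι → Bool) ℂ := pauliString k * ρ * pauliString k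

/-- The weight `w = (1 + e^{−2μ})/2` of one factor. [cite: vandenBergMinevKandalaTemme2023, eq. (1) ("where w_k = 2⁻¹(1 + e^{−2λ_k})") and SI eq. (S9)] -/
def weight (μ : ℝ) : ℝ := (1 + Real.exp (-2 * μ)) / 2

/-- One factor of the model, `ρ ↦ w_k ρ + (1 − w_k) P_k ρ P_k†` with `w_k = w(μ)`; the rate `μ` is an
arbitrary real here (`μ = λ_k ≥ 0` for the noise model, `−λ_k` for its inverse, `αλ_k` for the
amplified / attenuated model of [KimEtAl2023]). [cite: vandenBergMinevKandalaTemme2023, eq. (1) and SI eq. (S9)]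
[cite: KimEtAl2023, Methods ¶"Noise model" ("Λ(ρ) = ◯_i (w_i · + (1 − w_i) P_i · P_i†)(ρ)")] -/
def factor (k : ι → Pauli) (μ : ℝ) (ρ : Matrix (ι → Bool) (ι → Bool) ℂ) : Matrix (ι → Bool) (ι → Bool) ℂ :=
  ((weight μ : ℝ) : ℂ) • ρ + ((1 - weight μ : ℝ) : ℂ) • conjBy k ρ

/-- **The sparse Pauli–Lindblad channel** `Λ = exp[L] = Π_{k∈𝒦} (w_k · + (1 − w_k) P_k · P_k†)` of a
list of model Paulis with rates `(P_k, λ_k)` (the order is immaterial, `factor_comm`).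
[cite: vandenBergMinevKandalaTemme2023, eq. (1) and SI eqs. (S4)–(S9)] -/
def channel : List ((ι → Pauli) × ℝ) → Matrix (ι → Bool) (ι → Bool) ℂ → Matrix (ι → Bool) (ι → Bool) ℂ
  | [] => id
  | kμ :: L => factor kμ.1 kμ.2 ∘ channel L

/-- The Pauli fidelity of one factor on `P_a`: `1` if `[P_k, P_a] = 0`, `2w_k − 1 = e^{−2μ}` otherwise.
[cite: vandenBergMinevKandalaTemme2023, SI eq. (S10) (the factor `(2w_k − 1)` for `⟨a,k⟩_sp = 1`)] -/
def factorFid (k : ι → Pauli) (μ : ℝ) (a : ι → Pauli) : ℝ :=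
  if strSign k a = 1 then 1 else Real.exp (-2 * μ)

/-- The Pauli fidelity `f_a = Π_{⟨a,k⟩_sp = 1} (2w_k − 1)` of the channel of a list.
[cite: vandenBergMinevKandalaTemme2023, SI eq. (S10)] -/
def fidelity (L : List ((ι → Pauli) × ℝ)) (a : ι → Pauli) : ℝ :=
  (L.map fun kμ => factorFid kμ.1 kμ.2 a).prod

/-- The exponent `(Mλ)_a = Σ_k λ_k ⟨a,k⟩_sp` (`⟨a,k⟩_sp = 0` if `P_a`, `P_k` commute, `1` otherwise — the
tree's `strSign k a = ±1`). [cite: vandenBergMinevKandalaTemme2023, eq. (2) ("log(f) = −2M(B,K)λ … M_{b,k} = ⟨b,k⟩_sp") and SI eq. (S11)] -/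
def exponent (L : List ((ι → Pauli) × ℝ)) (a : ι → Pauli) : ℝ :=
  (L.map fun kμ => if strSign kμ.1 a = 1 then 0 else kμ.2).sum

/-- Negating the model coefficients ("The inverse noise model is obtained simply by negating the model
coefficients"). [cite: vandenBergMinevKandalaTemme2023, p. 1 and SI §SIII A] -/
def negRates (L : List ((ι → Pauli) × ℝ)) : List ((ι → Pauli) × ℝ) := L.map fun kμ => (kμ.1, -kμ.2)

/-- Scaling the model coefficients by `α` ("the map `e^{Lα}` is obtained by simply multiplying the Pauli
rates `λ_i` by `α`"; "changing the evolution time amounts to scaling `λ`").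
[cite: KimEtAl2023, main text p. 3 (PEA paragraph)] [cite: vandenBergMinevKandalaTemme2023, SI §SIII A] -/
def scaleRates (α : ℝ) (L : List ((ι → Pauli) × ℝ)) : List ((ι → Pauli) × ℝ) :=
  L.map fun kμ => (kμ.1, α * kμ.2)

/-- The sampling-overhead factor of one (quasi-)probabilistic factor: the `ℓ₁`-norm `|w| + |1 − w|` of
its two coefficients (`γ := Σ_i |c_i|`). [cite: vandenBergMinevKandalaTemme2023, SI §SII B ("γ := Σ_i |c_i^inv|") and eq. (3)] -/
def factorCost (μ : ℝ) : ℝ := |weight μ| + |1 - weight μ|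

/-- The sampling overhead of the factorised (quasi-)probabilistic representation of the channel of a
list: the product of the factors' `ℓ₁`-norms. [cite: vandenBergMinevKandalaTemme2023, eq. (3) ("with sampling overhead γ = exp(Σ_k 2λ_k)") and SI §SII B] -/
def cost (L : List ((ι → Pauli) × ℝ)) : ℝ := (L.map fun kμ => factorCost kμ.2).prod

/-! ### The weights `w_k` -/

/-- `2w − 1 = e^{−2μ}`. [cite: vandenBergMinevKandalaTemme2023, SI eq. (S10) ("(2w_k − 1) = e^{−2λ_k}")] -/
theorem two_mul_weight_sub_one (μ : ℝ) : 2 * weight μ - 1 = Real.exp (-2 * μ) := by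
  unfold weight; ring

/-- `w > 0`. [cite: vandenBergMinevKandalaTemme2023, SI §SIII ("the coefficients w_k in (S9) are all nonnegative")] -/
theorem weight_pos (μ : ℝ) : 0 < weight μ := by
  unfold weight; positivity

/-- `w ≤ 1` for `μ ≥ 0` (so `1 − w ≥ 0`: a genuine probabilistic mixture). [cite: vandenBergMinevKandalaTemme2023, SI §SIII ("(S9) is a valid Pauli channel for all λ ≥ 0")] -/
theorem weight_le_one {μ : ℝ} (hμ : 0 ≤ μ) : weight μ ≤ 1 := by
  unfold weight
  have : Real.exp (-2 * μ) ≤ 1 := Real.exp_le_one_iff.mpr (by linarith)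
  linarith

/-- `w ≥ 1` for `μ ≤ 0` (so `1 − w ≤ 0`: a quasi-probability, "a non-physical map"). [cite: vandenBergMinevKandalaTemme2023, p. 3 ("leading to a non-physical map") and eq. (3)] -/
theorem one_le_weight {μ : ℝ} (hμ : μ ≤ 0) : 1 ≤ weight μ := by
  unfold weight
  have : 1 ≤ Real.exp (-2 * μ) := Real.one_le_exp_iff.mpr (by linarith)
  linarith

/-- A factor with `μ ≥ 0` costs nothing: `|w| + |1 − w| = 1`. [cite: KimEtAl2023, main text p. 3 ("for α ≥ 0, the map is a Pauli channel that can be sampled directly")] -/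
theorem factorCost_of_nonneg {μ : ℝ} (hμ : 0 ≤ μ) : factorCost μ = 1 := by
  unfold factorCost
  rw [abs_of_pos (weight_pos μ), abs_of_nonneg (by linarith [weight_le_one hμ])]; ring

/-- A factor with `μ ≤ 0` has `ℓ₁`-norm `|w| + |1 − w| = 2w − 1 = e^{−2μ}`. [cite: vandenBergMinevKandalaTemme2023, eq. (3)]
[cite: KimEtAl2023, main text p. 3 ("for α < 0, quasi-probabilistic sampling is needed with sampling overhead γ^{−2α}")] -/
theorem factorCost_of_nonpos {μ : ℝ} (hμ : μ ≤ 0) : factorCost μ = Real.exp (-2 * μ) := by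
  unfold factorCost
  rw [abs_of_pos (weight_pos μ), abs_of_nonpos (by linarith [one_le_weight hμ]),
    ← two_mul_weight_sub_one]; ring

/-! ### Conjugation by a Pauli string -/

/-- `P_k (P_k ρ P_k) P_k = ρ`. [cite: KimEtAl2023, Methods ¶"Noise model" ("P_i P_i† = I")] -/
theorem conjBy_conjBy (k : ι → Pauli) (ρ : Matrix (ι → Bool) (ι → Bool) ℂ) : conjBy k (conjBy k ρ) = ρ := by
  unfold conjBy
  calc pauliString k * (pauliString k * ρ * pauliString k) * pauliString k
      = (pauliString k * pauliString k) * ρ * (pauliString k * pauliString k) := by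
        simp only [Matrix.mul_assoc]
    _ = ρ := by rw [pauliString_mul_self, Matrix.one_mul, Matrix.mul_one]

/-- Conjugation is additive. [cite: vandenBergMinevKandalaTemme2023, SI eq. (S4)] -/
theorem conjBy_add (k : ι → Pauli) (ρ σ : Matrix (ι → Bool) (ι → Bool) ℂ) : conjBy k (ρ + σ) = conjBy k ρ + conjBy k σ := by
  unfold conjBy; rw [Matrix.mul_add, Matrix.add_mul]

/-- Conjugation is homogeneous. [cite: vandenBergMinevKandalaTemme2023, SI eq. (S4)] -/
theorem conjBy_smul (k : ι → Pauli) (c : ℂ) (ρ : Matrix (ι → Bool) (ι → Bool) ℂ) : conjBy k (c • ρ) = c • conjBy k ρ := by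
  unfold conjBy; rw [Matrix.mul_smul, Matrix.smul_mul]

/-- `P_k P_a P_k = ± P_a` according to whether `P_k`, `P_a` commute. [cite: vandenBergMinevKandalaTemme2023, SI eq. (S10) and main text ("⟨b,k⟩_sp … 0 if Paulis P_b and P_k commute and 1 otherwise")] -/
theorem conjBy_pauliString (k a : ι → Pauli) : conjBy k (pauliString a) = strSign k a • pauliString a :=
  pauliString_conj_eq_strSign_smul k a

/-- Pauli conjugations commute: `P_k (P_j ρ P_j) P_k = P_j (P_k ρ P_k) P_j`. [cite: vandenBergMinevKandalaTemme2023, SI §SIII ("This shows that the terms in (S6) commute, and also expresses the fact that Pauli channels commute")] -/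
theorem conjBy_comm (k j : ι → Pauli) (ρ : Matrix (ι → Bool) (ι → Bool) ℂ) : conjBy k (conjBy j ρ) = conjBy j (conjBy k ρ) := by
  unfold conjBy
  have h1 : pauliString k * pauliString j = strSign k j • (pauliString j * pauliString k) :=
    pauliString_mul_comm_smul k j
  calc pauliString k * (pauliString j * ρ * pauliString j) * pauliString k
      = (pauliString k * pauliString j) * ρ * (pauliString j * pauliString k) := by
        simp only [Matrix.mul_assoc]
    _ = (strSign k j • (pauliString j * pauliString k)) * ρ * (pauliString j * pauliString k) := by
        rw [h1]
    _ = (pauliString j * pauliString k) * ρ * (strSign k j • (pauliString j * pauliString k)) := by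
        rw [Matrix.smul_mul, Matrix.smul_mul, Matrix.mul_smul]
    _ = (pauliString j * pauliString k) * ρ * (pauliString k * pauliString j) := by rw [← h1]
    _ = pauliString j * (pauliString k * ρ * pauliString k) * pauliString j := by
        simp only [Matrix.mul_assoc]

/-- Conjugation preserves the trace. [cite: vandenBergMinevKandalaTemme2023, SI §SIII] -/
theorem trace_conjBy (k : ι → Pauli) (ρ : Matrix (ι → Bool) (ι → Bool) ℂ) : (conjBy k ρ).trace = ρ.trace := by
  unfold conjBy
  rw [Matrix.trace_mul_cycle, pauliString_mul_self, Matrix.one_mul]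

/-! ### One factor `w · + (1 − w) P_k · P_k†` -/

/-- A factor is additive. [cite: vandenBergMinevKandalaTemme2023, eq. (1)] -/
theorem factor_add (k : ι → Pauli) (μ : ℝ) (ρ σ : Matrix (ι → Bool) (ι → Bool) ℂ) :
    factor k μ (ρ + σ) = factor k μ ρ + factor k μ σ := by
  unfold factor; rw [conjBy_add, smul_add, smul_add]; abel

/-- A factor is homogeneous. [cite: vandenBergMinevKandalaTemme2023, eq. (1)] -/
theorem factor_smul (k : ι → Pauli) (μ : ℝ) (c : ℂ) (ρ : Matrix (ι → Bool) (ι → Bool) ℂ) :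
    factor k μ (c • ρ) = c • factor k μ ρ := by
  unfold factor; rw [conjBy_smul, smul_comm _ c, smul_comm _ c (conjBy k ρ), ← smul_add]

/-- Rate `0` gives the identity map (`w(0) = 1`). [cite: vandenBergMinevKandalaTemme2023, SI §SIII A ("changing the evolution time amounts to scaling λ")] -/
theorem factor_zero (k : ι → Pauli) (ρ : Matrix (ι → Bool) (ι → Bool) ℂ) : factor k 0 ρ = ρ := by
  unfold factor weight; simp

/-- A factor preserves the trace (`w + (1 − w) = 1`). [cite: vandenBergMinevKandalaTemme2023, SI §SIII ("(S9) is a valid Pauli channel")] -/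
theorem trace_factor (k : ι → Pauli) (μ : ℝ) (ρ : Matrix (ι → Bool) (ι → Bool) ℂ) : (factor k μ ρ).trace = ρ.trace := by
  unfold factor
  rw [Matrix.trace_add, Matrix.trace_smul, Matrix.trace_smul, trace_conjBy, ← add_smul]
  push_cast
  rw [add_sub_cancel, one_smul]

/-- **Pauli strings are eigen-operators of a factor**: `P_a ↦ P_a` if `[P_k,P_a] = 0`, `↦ (2w_k − 1) P_a`
otherwise. [cite: vandenBergMinevKandalaTemme2023, SI eq. (S10)] -/
theorem factor_pauliString (k : ι → Pauli) (μ : ℝ) (a : ι → Pauli) :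
    factor k μ (pauliString a) = ((factorFid k μ a : ℝ) : ℂ) • pauliString a := by
  unfold factor factorFid
  rw [conjBy_pauliString, smul_smul, ← add_smul]
  congr 1
  rcases strSign_eq_one_or k a with h | h
  · rw [h, if_pos rfl]; push_cast; ring
  · rw [h, if_neg (by norm_num), ← two_mul_weight_sub_one]; push_cast; ring

/-- **Channel operations, one factor**: composing two factors on the same Pauli ADDS the rates,
`(w_μ · + (1−w_μ)C)(w_ν · + (1−w_ν)C) = w_{μ+ν} · + (1 − w_{μ+ν})C` ("combination of channels amounts to
addition of the coefficients"; "changing the evolution time amounts to scaling λ"). [cite: vandenBergMinevKandalaTemme2023, SI §SIII A] -/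
theorem factor_comp (k : ι → Pauli) (μ ν : ℝ) (ρ : Matrix (ι → Bool) (ι → Bool) ℂ) :
    factor k μ (factor k ν ρ) = factor k (μ + ν) ρ := by
  unfold factor
  rw [conjBy_add, conjBy_smul, conjBy_smul, conjBy_conjBy, smul_add, smul_add, smul_smul, smul_smul,
    smul_smul, smul_smul]
  have key1 : ((weight μ : ℝ) : ℂ) * ((weight ν : ℝ) : ℂ) +
      ((1 - weight μ : ℝ) : ℂ) * ((1 - weight ν : ℝ) : ℂ) = ((weight (μ + ν) : ℝ) : ℂ) := by
    have : weight μ * weight ν + (1 - weight μ) * (1 - weight ν) = weight (μ + ν) := by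
      unfold weight
      have : Real.exp (-2 * (μ + ν)) = Real.exp (-2 * μ) * Real.exp (-2 * ν) := by
        rw [← Real.exp_add]; ring_nf
      rw [this]; ring
    exact_mod_cast this
  have key2 : ((weight μ : ℝ) : ℂ) * ((1 - weight ν : ℝ) : ℂ) +
      ((1 - weight μ : ℝ) : ℂ) * ((weight ν : ℝ) : ℂ) = ((1 - weight (μ + ν) : ℝ) : ℂ) := by
    have : weight μ * (1 - weight ν) + (1 - weight μ) * weight ν = 1 - weight (μ + ν) := by
      unfold weight
      have : Real.exp (-2 * (μ + ν)) = Real.exp (-2 * μ) * Real.exp (-2 * ν) := by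
        rw [← Real.exp_add]; ring_nf
      rw [this]; ring
    exact_mod_cast this
  rw [← key1, ← key2, add_smul, add_smul]
  abel

/-- **Inversion by negation, one factor**: the factor with rate `−μ` inverts the factor with rate `μ`
("amounts exactly to inverting each individual factor in Eq. (1)"). [cite: vandenBergMinevKandalaTemme2023, eq. (3) and SI §SIII A ("the inverse noise model is obtained by simply negating the coefficients")] -/
theorem factor_neg_comp (k : ι → Pauli) (μ : ℝ) (ρ : Matrix (ι → Bool) (ι → Bool) ℂ) : factor k (-μ) (factor k μ ρ) = ρ := by
  rw [factor_comp, neg_add_cancel, factor_zero]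

/-- … and is inverted by it. [cite: vandenBergMinevKandalaTemme2023, eq. (3)] -/
theorem factor_comp_neg (k : ι → Pauli) (μ : ℝ) (ρ : Matrix (ι → Bool) (ι → Bool) ℂ) : factor k μ (factor k (-μ) ρ) = ρ := by
  rw [factor_comp, add_neg_cancel, factor_zero]

/-- **The factors commute** ("due to commutativity of the factors"). [cite: vandenBergMinevKandalaTemme2023, p. 3 (text after eq. (3)) and SI §SIII] -/
theorem factor_comm (k j : ι → Pauli) (μ ν : ℝ) (ρ : Matrix (ι → Bool) (ι → Bool) ℂ) :
    factor k μ (factor j ν ρ) = factor j ν (factor k μ ρ) := by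
  unfold factor
  rw [conjBy_add, conjBy_smul, conjBy_smul, conjBy_add, conjBy_smul, conjBy_smul, conjBy_comm k j]
  module

/-- **The printed inverse factor**: `w_{−μ} · + (1 − w_{−μ}) C = e^{2μ} (w_μ · − (1 − w_μ) C)` — eq. (3)'s
`γ ∏_k (w_k · − (1 − w_k) P_k · P_k†)` with `γ_k = e^{2λ_k}`. [cite: vandenBergMinevKandalaTemme2023, eq. (3)] -/
theorem factor_neg_eq (k : ι → Pauli) (μ : ℝ) (ρ : Matrix (ι → Bool) (ι → Bool) ℂ) :
    factor k (-μ) ρ = ((Real.exp (2 * μ) : ℝ) : ℂ) •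
      (((weight μ : ℝ) : ℂ) • ρ - ((1 - weight μ : ℝ) : ℂ) • conjBy k ρ) := by
  have e1 : Real.exp (2 * μ) * Real.exp (-2 * μ) = 1 := by
    rw [← Real.exp_add]; ring_nf; exact Real.exp_zero
  have e2 : Real.exp (-2 * -μ) = Real.exp (2 * μ) := by ring_nf
  have h1 : weight (-μ) = Real.exp (2 * μ) * weight μ := by
    unfold weight; rw [e2]; linear_combination (-1 / 2 : ℝ) * e1
  have h2 : 1 - weight (-μ) = -(Real.exp (2 * μ) * (1 - weight μ)) := by
    unfold weight; rw [e2]; linear_combination (-1 / 2 : ℝ) * e1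
  unfold factor
  rw [h2, h1]
  push_cast
  module

/-! ### The channel of a list of model Paulis; inversion by negation (eq. (3)) -/

/-- The empty model is the identity channel. [cite: vandenBergMinevKandalaTemme2023, eq. (1)] -/
theorem channel_nil (ρ : Matrix (ι → Bool) (ι → Bool) ℂ) : channel ([] : List ((ι → Pauli) × ℝ)) ρ = ρ := rfl

/-- Unfolding: `Λ_{(k,μ)::L} = (w · + (1−w) P_k·P_k) ∘ Λ_L`. [cite: vandenBergMinevKandalaTemme2023, eq. (1)] -/
theorem channel_cons (k : ι → Pauli) (μ : ℝ) (L : List ((ι → Pauli) × ℝ)) (ρ : Matrix (ι → Bool) (ι → Bool) ℂ) :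
    channel ((k, μ) :: L) ρ = factor k μ (channel L ρ) := rfl

/-- **Pauli strings are eigen-operators of the model, with eigenvalue the fidelity**:
`Λ(P_a) = f_a P_a`, `f_a = Π_{⟨a,k⟩_sp=1} (2w_k − 1)`. [cite: vandenBergMinevKandalaTemme2023, SI eq. (S10)] -/
theorem channel_pauliString (L : List ((ι → Pauli) × ℝ)) (a : ι → Pauli) :
    channel L (pauliString a) = ((fidelity L a : ℝ) : ℂ) • pauliString a := by
  induction L with
  | nil => simp [channel, fidelity]
  | cons kμ L ih =>
    rw [show channel (kμ :: L) (pauliString a) = factor kμ.1 kμ.2 (channel L (pauliString a)) from rfl,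
      ih, factor_smul, factor_pauliString, smul_smul]
    unfold fidelity
    rw [List.map_cons, List.prod_cons]; push_cast; ring_nf

/-- The model is trace preserving. [cite: vandenBergMinevKandalaTemme2023, SI §SIII ("(S9) is a valid Pauli channel for all λ ≥ 0")] -/
theorem trace_channel (L : List ((ι → Pauli) × ℝ)) (ρ : Matrix (ι → Bool) (ι → Bool) ℂ) : (channel L ρ).trace = ρ.trace := by
  induction L with
  | nil => rfl
  | cons kμ L ih =>
    rw [show channel (kμ :: L) ρ = factor kμ.1 kμ.2 (channel L ρ) from rfl, trace_factor, ih]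

/-- The model is additive. [cite: vandenBergMinevKandalaTemme2023, eq. (1)] -/
theorem channel_add (L : List ((ι → Pauli) × ℝ)) (ρ σ : Matrix (ι → Bool) (ι → Bool) ℂ) :
    channel L (ρ + σ) = channel L ρ + channel L σ := by
  induction L with
  | nil => rfl
  | cons kμ L ih =>
    simp only [show ∀ τ, channel (kμ :: L) τ = factor kμ.1 kμ.2 (channel L τ) from fun _ => rfl]
    rw [ih, factor_add]

/-- The model is homogeneous. [cite: vandenBergMinevKandalaTemme2023, eq. (1)] -/
theorem channel_smul (L : List ((ι → Pauli) × ℝ)) (c : ℂ) (ρ : Matrix (ι → Bool) (ι → Bool) ℂ) :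
    channel L (c • ρ) = c • channel L ρ := by
  induction L with
  | nil => rfl
  | cons kμ L ih =>
    simp only [show ∀ τ, channel (kμ :: L) τ = factor kμ.1 kμ.2 (channel L τ) from fun _ => rfl]
    rw [ih, factor_smul]

/-- A factor commutes with the channel of any list. [cite: vandenBergMinevKandalaTemme2023, p. 3 ("due to commutativity of the factors")] -/
theorem factor_channel_comm (k : ι → Pauli) (μ : ℝ) (L : List ((ι → Pauli) × ℝ)) (ρ : Matrix (ι → Bool) (ι → Bool) ℂ) :
    factor k μ (channel L ρ) = channel L (factor k μ ρ) := by
  induction L generalizing ρ with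
  | nil => rfl
  | cons jν L ih =>
    simp only [show ∀ τ, channel (jν :: L) τ = factor jν.1 jν.2 (channel L τ) from fun _ => rfl]
    rw [factor_comm, ih]

/-- **Eq. (3): the negated model inverts the model**, `Λ_{−λ} ∘ Λ_λ = id` ("Λ⁻¹(ρ) = exp[−L](ρ) … This
amounts exactly to inverting each individual factor in Eq. (1) due to commutativity of the factors";
Kim et al.: "In PEC, we choose α = −1 to obtain an overall zero-gain noise level").
[cite: vandenBergMinevKandalaTemme2023, eq. (3)] [cite: KimEtAl2023, main text p. 3] -/
theorem channel_negRates_channel (L : List ((ι → Pauli) × ℝ)) (ρ : Matrix (ι → Bool) (ι → Bool) ℂ) :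
    channel (negRates L) (channel L ρ) = ρ := by
  induction L generalizing ρ with
  | nil => rfl
  | cons kμ L ih =>
    simp only [negRates, List.map_cons] at ih ⊢
    simp only [show ∀ τ, channel (kμ :: L) τ = factor kμ.1 kμ.2 (channel L τ) from fun _ => rfl,
      show ∀ τ, channel ((kμ.1, -kμ.2) :: List.map (fun kμ => (kμ.1, -kμ.2)) L) τ =
        factor kμ.1 (-kμ.2) (channel (List.map (fun kμ => (kμ.1, -kμ.2)) L) τ) from fun _ => rfl]
    rw [← factor_channel_comm kμ.1 kμ.2, factor_neg_comp]
    exact ih ρ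

/-- … and `Λ_λ ∘ Λ_{−λ} = id`. [cite: vandenBergMinevKandalaTemme2023, eq. (3)] -/
theorem channel_channel_negRates (L : List ((ι → Pauli) × ℝ)) (ρ : Matrix (ι → Bool) (ι → Bool) ℂ) :
    channel L (channel (negRates L) ρ) = ρ := by
  induction L generalizing ρ with
  | nil => rfl
  | cons kμ L ih =>
    simp only [negRates, List.map_cons] at ih ⊢
    simp only [show ∀ τ, channel (kμ :: L) τ = factor kμ.1 kμ.2 (channel L τ) from fun _ => rfl,
      show ∀ τ, channel ((kμ.1, -kμ.2) :: List.map (fun kμ => (kμ.1, -kμ.2)) L) τ =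
        factor kμ.1 (-kμ.2) (channel (List.map (fun kμ => (kμ.1, -kμ.2)) L) τ) from fun _ => rfl]
    rw [← factor_channel_comm kμ.1 (-kμ.2), factor_comp_neg]
    exact ih ρ

/-! ### Pauli fidelities (eqs. (S10)–(S11)); scaling, gain, inversion -/

omit [DecidableEq ι] in
/-- `(2w_k − 1)^{⟨a,k⟩} = e^{−2μ⟨a,k⟩}`. [cite: vandenBergMinevKandalaTemme2023, SI eq. (S10)] -/
theorem factorFid_eq_exp (k : ι → Pauli) (μ : ℝ) (a : ι → Pauli) :
    factorFid k μ a = Real.exp (-2 * if strSign k a = 1 then 0 else μ) := by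
  unfold factorFid; split_ifs <;> simp

omit [DecidableEq ι] in
/-- **Eq. (S10)**: `f_a = exp(−2 Σ_k λ_k ⟨a,k⟩_sp)`. [cite: vandenBergMinevKandalaTemme2023, SI eq. (S10) and main text eq. (2) ("log(f) = −2M(B,K)λ")] -/
theorem fidelity_eq_exp (L : List ((ι → Pauli) × ℝ)) (a : ι → Pauli) :
    fidelity L a = Real.exp (-2 * exponent L a) := by
  induction L with
  | nil => simp [fidelity, exponent]
  | cons kμ L ih =>
    unfold fidelity exponent at *
    rw [List.map_cons, List.prod_cons, List.map_cons, List.sum_cons, ih, factorFid_eq_exp,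
      ← Real.exp_add]; ring_nf

omit [DecidableEq ι] in
/-- `f_a > 0`. [cite: vandenBergMinevKandalaTemme2023, SI eq. (S10)] -/
theorem fidelity_pos (L : List ((ι → Pauli) × ℝ)) (a : ι → Pauli) : 0 < fidelity L a := by
  rw [fidelity_eq_exp]; exact Real.exp_pos _

omit [DecidableEq ι] in
/-- **Eq. (S11)**: `−log(f_a)/2 = (Mλ)_a`. [cite: vandenBergMinevKandalaTemme2023, SI eq. (S11)] -/
theorem neg_log_fidelity_div_two (L : List ((ι → Pauli) × ℝ)) (a : ι → Pauli) :
    -Real.log (fidelity L a) / 2 = exponent L a := by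
  rw [fidelity_eq_exp, Real.log_exp]; ring

omit [DecidableEq ι] in
/-- "the fidelity for the identity operator is always one, since all Pauli terms commute with the
identity". [cite: vandenBergMinevKandalaTemme2023, SI §SIII (sentence after (S11))] -/
theorem fidelity_const_I (L : List ((ι → Pauli) × ℝ)) : fidelity L (fun _ => Pauli.I) = 1 := by
  unfold fidelity
  refine List.prod_eq_one fun x hx => ?_
  rw [List.mem_map] at hx
  obtain ⟨kμ, -, rfl⟩ := hx
  unfold factorFid; rw [if_pos (strSign_const_I _)]

omit [DecidableEq ι] in
/-- `(Mλ)_a ≥ 0` for `λ ≥ 0`. [cite: vandenBergMinevKandalaTemme2023, SI §SIII ("non-negative numbers λ_k ≥ 0")] -/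
theorem exponent_nonneg {L : List ((ι → Pauli) × ℝ)} (hL : ∀ kμ ∈ L, 0 ≤ kμ.2) (a : ι → Pauli) :
    0 ≤ exponent L a := by
  unfold exponent
  refine List.sum_nonneg fun x hx => ?_
  rw [List.mem_map] at hx
  obtain ⟨kμ, hk, rfl⟩ := hx
  split_ifs
  · exact le_rfl
  · exact hL kμ hk

omit [DecidableEq ι] in
/-- `f_a ≤ 1` for `λ ≥ 0`. [cite: vandenBergMinevKandalaTemme2023, SI §SIII ("(S9) is a valid Pauli channel for all λ ≥ 0")] -/
theorem fidelity_le_one {L : List ((ι → Pauli) × ℝ)} (hL : ∀ kμ ∈ L, 0 ≤ kμ.2) (a : ι → Pauli) :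
    fidelity L a ≤ 1 := by
  rw [fidelity_eq_exp, Real.exp_le_one_iff]
  have := exponent_nonneg hL a
  linarith

omit [DecidableEq ι] in
/-- **Multiplicativity of fidelities under successive channels**: `f_a(L₁ ++ L₂) = f_a(L₁) f_a(L₂)`.
[cite: vandenBergMinevKandalaTemme2023, SI §SIII A ("it follows from multiplicativity of fidelities under successive Pauli channels that −log(f₁f₂)/2 = … = M(λ₁ + λ₂)")] -/
theorem fidelity_append (L₁ L₂ : List ((ι → Pauli) × ℝ)) (a : ι → Pauli) :
    fidelity (L₁ ++ L₂) a = fidelity L₁ a * fidelity L₂ a := by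
  unfold fidelity; rw [List.map_append, List.prod_append]

omit [DecidableEq ι] in
/-- "combination of channels amounts to addition of the coefficients": `(M(λ₁+λ₂))_a = (Mλ₁)_a + (Mλ₂)_a`.
[cite: vandenBergMinevKandalaTemme2023, SI §SIII A] -/
theorem exponent_append (L₁ L₂ : List ((ι → Pauli) × ℝ)) (a : ι → Pauli) :
    exponent (L₁ ++ L₂) a = exponent L₁ a + exponent L₂ a := by
  unfold exponent; rw [List.map_append, List.sum_append]

omit [DecidableEq ι] in
/-- Scaling the rates scales the exponent. [cite: vandenBergMinevKandalaTemme2023, SI §SIII A ("changing the evolution time amounts to scaling λ")] -/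
theorem exponent_scaleRates (α : ℝ) (L : List ((ι → Pauli) × ℝ)) (a : ι → Pauli) :
    exponent (scaleRates α L) a = α * exponent L a := by
  induction L with
  | nil => simp [exponent, scaleRates]
  | cons kμ L ih =>
    unfold exponent scaleRates at *
    rw [List.map_cons, List.map_cons, List.sum_cons, List.map_cons, List.sum_cons, ih]
    split_ifs <;> ring

omit [DecidableEq ι] in
/-- Negating the rates negates the exponent (`−log(1/f)/2 = M(−λ)`). [cite: vandenBergMinevKandalaTemme2023, SI §SIII A] -/
theorem exponent_negRates (L : List ((ι → Pauli) × ℝ)) (a : ι → Pauli) :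
    exponent (negRates L) a = -exponent L a := by
  have : negRates L = scaleRates (-1) L := by
    unfold negRates scaleRates; simp
  rw [this, exponent_scaleRates]; ring

omit [DecidableEq ι] in
/-- **Probabilistic error amplification**: the model with rates `αλ` has fidelities `f_a^α` ("applying
`Λ^α` … the map `e^{Lα}` is obtained by simply multiplying the Pauli rates `λ_i` by `α`").
[cite: KimEtAl2023, main text p. 3 (PEA paragraph)] [cite: vandenBergMinevKandalaTemme2023, SI §SIII A] -/
theorem fidelity_scaleRates (α : ℝ) (L : List ((ι → Pauli) × ℝ)) (a : ι → Pauli) :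
    fidelity (scaleRates α L) a = fidelity L a ^ α := by
  rw [fidelity_eq_exp, fidelity_eq_exp, exponent_scaleRates, ← Real.exp_mul]; ring_nf

omit [DecidableEq ι] in
/-- "The inverse of a channel is characterized by inverse fidelities": `f_a(−λ) = 1/f_a(λ)`.
[cite: vandenBergMinevKandalaTemme2023, SI §SIII A and §SII B ("T_Λ⁻¹ = diag(f_a⁻¹)")] -/
theorem fidelity_negRates (L : List ((ι → Pauli) × ℝ)) (a : ι → Pauli) :
    fidelity (negRates L) a = (fidelity L a)⁻¹ := by
  rw [fidelity_eq_exp, fidelity_eq_exp, exponent_negRates, ← Real.exp_neg]; ring_nf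

omit [DecidableEq ι] in
/-- **Gain**: "applying `Λ^α` before the noisy layer produces an overall noise channel `Λ^G` with gain
`G = α + 1`": the fidelities of `Λ_{αλ} ∘ Λ_λ` are `f_a^{α+1}`. [cite: KimEtAl2023, main text p. 3 (PEA paragraph)] -/
theorem fidelity_scaleRates_append (α : ℝ) (L : List ((ι → Pauli) × ℝ)) (a : ι → Pauli) :
    fidelity (scaleRates α L ++ L) a = fidelity L a ^ (α + 1) := by
  rw [fidelity_append, fidelity_scaleRates, Real.rpow_add (fidelity_pos L a), Real.rpow_one]

/-- The printed definition of the fidelity agrees: `f_a = 2^{−n} Tr(P_a† Λ(P_a))`.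
[cite: vandenBergMinevKandalaTemme2023, main text ("The fidelity of a Pauli matrix P_b with respect to Λ is given by f_b = (1/2ⁿ) Tr(P_b† Λ(P_b))") and SI eq. (S10)] -/
theorem fidelity_eq_trace (L : List ((ι → Pauli) × ℝ)) (a : ι → Pauli) :
    ((fidelity L a : ℝ) : ℂ) =
      ((2 : ℂ) ^ Fintype.card ι)⁻¹ * ((pauliString a)ᴴ * channel L (pauliString a)).trace := by
  rw [channel_pauliString, conjTranspose_pauliString, Matrix.mul_smul, Matrix.trace_smul,
    trace_pauliString_mul_pauliString, if_pos rfl, smul_eq_mul]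
  have h2 : ((2 : ℂ) ^ Fintype.card ι) ≠ 0 := pow_ne_zero _ two_ne_zero
  field_simp

/-! ### Sampling overhead -/

omit [Fintype ι] [DecidableEq ι] in
/-- A model with nonnegative rates is sampled at no overhead (`γ = 1`: "For each `k ∈ 𝒦` we sample the
identity with probability `w_k` or apply the Pauli `P_k` otherwise"). [cite: vandenBergMinevKandalaTemme2023, p. 3]
[cite: KimEtAl2023, main text p. 3 ("for α ≥ 0, the map is a Pauli channel that can be sampled directly")] -/
theorem cost_of_nonneg {L : List ((ι → Pauli) × ℝ)} (hL : ∀ kμ ∈ L, 0 ≤ kμ.2) : cost L = 1 := by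
  unfold cost
  refine List.prod_eq_one fun x hx => ?_
  rw [List.mem_map] at hx
  obtain ⟨kμ, hk, rfl⟩ := hx
  exact factorCost_of_nonneg (hL kμ hk)

omit [Fintype ι] [DecidableEq ι] in
/-- A model with nonpositive rates `μ_k` has overhead `Π_k e^{−2μ_k} = exp(−2 Σ_k μ_k)`. [cite: vandenBergMinevKandalaTemme2023, eq. (3)] -/
theorem cost_of_nonpos {L : List ((ι → Pauli) × ℝ)} (hL : ∀ kμ ∈ L, kμ.2 ≤ 0) :
    cost L = Real.exp (-2 * (L.map Prod.snd).sum) := by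
  induction L with
  | nil => simp [cost]
  | cons kμ L ih =>
    unfold cost at *
    rw [List.map_cons, List.prod_cons, List.map_cons, List.sum_cons,
      factorCost_of_nonpos (hL kμ List.mem_cons_self),
      ih (fun x hx => hL x (List.mem_cons_of_mem _ hx)), ← Real.exp_add]
    ring_nf

omit [Fintype ι] [DecidableEq ι] in
/-- **Eq. (3): the sampling overhead of the inverse model is `γ = exp(Σ_k 2λ_k)`** (the estimator's
variance grows "by a factor of O(γ²)", SI §SII B; `γ(l) = Π_i γ_i` over layers is `cost` of the
concatenated lists, `List.prod_append`). [cite: vandenBergMinevKandalaTemme2023, eq. (3) and SI §SII B] -/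
theorem cost_negRates {L : List ((ι → Pauli) × ℝ)} (hL : ∀ kμ ∈ L, 0 ≤ kμ.2) :
    cost (negRates L) = Real.exp (2 * (L.map Prod.snd).sum) := by
  rw [cost_of_nonpos]
  · unfold negRates
    rw [List.map_map]
    have : (List.map (Prod.snd ∘ fun kμ : (ι → Pauli) × ℝ => (kμ.1, -kμ.2)) L).sum =
        -(L.map Prod.snd).sum := by
      induction L with
      | nil => simp
      | cons x L ih =>
        rw [List.map_cons, List.sum_cons, List.map_cons, List.sum_cons,
          ih (fun y hy => hL y (List.mem_cons_of_mem _ hy))]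
        simp; ring
    rw [this]; ring_nf
  · intro x hx
    unfold negRates at hx
    rw [List.mem_map] at hx
    obtain ⟨kμ, hk, rfl⟩ := hx
    simpa using hL kμ hk

omit [Fintype ι] [DecidableEq ι] in
/-- **Kim et al.'s overhead `γ^{−2α}`** for the attenuated model `α ≤ 0`, with the "model-specific"
`γ = exp(Σ_i λ_i)` (so that PEC, `α = −1`, costs `γ² = exp(2Σλ)`, van den Berg et al.'s `γ`).
[cite: KimEtAl2023, main text p. 3 ("for α < 0, quasi-probabilistic sampling is needed with sampling overhead γ^{−2α} for some model-specific γ. In PEC, we choose α = −1")] -/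
theorem cost_scaleRates {α : ℝ} (hα : α ≤ 0) {L : List ((ι → Pauli) × ℝ)} (hL : ∀ kμ ∈ L, 0 ≤ kμ.2) :
    cost (scaleRates α L) = Real.exp ((L.map Prod.snd).sum) ^ (-2 * α) := by
  rw [cost_of_nonpos, ← Real.exp_mul]
  · unfold scaleRates
    rw [List.map_map]
    have : (List.map (Prod.snd ∘ fun kμ : (ι → Pauli) × ℝ => (kμ.1, α * kμ.2)) L).sum =
        α * (L.map Prod.snd).sum := by
      induction L with
      | nil => simp
      | cons x L ih =>
        rw [List.map_cons, List.sum_cons, List.map_cons, List.sum_cons,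
          ih (fun y hy => hL y (List.mem_cons_of_mem _ hy))]
        simp; ring
    rw [this]; ring_nf
  · intro x hx
    unfold scaleRates at hx
    rw [List.mem_map] at hx
    obtain ⟨kμ, hk, rfl⟩ := hx
    exact mul_nonpos_of_nonpos_of_nonneg hα (hL kμ hk)

/-! ### Each factor is a Pauli channel -/

/-- The Pauli error rates of one factor: `w` on the identity string, `1 − w` on `P_k`.
[cite: vandenBergMinevKandalaTemme2023, eq. (1)] -/
def factorRates (k : ι → Pauli) (μ : ℝ) (S : ι → Pauli) : ℝ :=
  (if S = fun _ => Pauli.I then weight μ else 0) + (if S = k then 1 - weight μ else 0)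

/-- **Each factor is a Pauli channel** (of the sibling file `PauliChannelEstimation.lean`) with rates
`w` on `I` and `1 − w` on `P_k`. [cite: vandenBergMinevKandalaTemme2023, eq. (1)] -/
theorem factor_eq_pauliChannel (k : ι → Pauli) (μ : ℝ) (ρ : Matrix (ι → Bool) (ι → Bool) ℂ) :
    factor k μ ρ = pauliChannel (fun S => ((factorRates k μ S : ℝ) : ℂ)) ρ := by
  unfold factor factorRates conjBy
  rw [pauliChannel_eq]
  simp only [Complex.ofReal_add, add_smul, Finset.sum_add_distrib]
  simp only [apply_ite Complex.ofReal, Complex.ofReal_zero, ite_smul, zero_smul,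
    Finset.sum_ite_eq', Finset.mem_univ, if_true, pauliString_const_I, Matrix.one_mul, Matrix.mul_one]

omit [DecidableEq ι] in
/-- … whose rates are nonnegative for `μ ≥ 0`. [cite: vandenBergMinevKandalaTemme2023, SI §SIII ("the coefficients w_k in (S9) are all nonnegative … (S9) is a valid Pauli channel for all λ ≥ 0")] -/
theorem factorRates_nonneg (k : ι → Pauli) {μ : ℝ} (hμ : 0 ≤ μ) (S : ι → Pauli) :
    0 ≤ factorRates k μ S := by
  unfold factorRates
  have h1 := weight_pos μ
  have h2 := weight_le_one hμ
  split_ifs <;> linarith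

/-- … and sum to `1`. [cite: vandenBergMinevKandalaTemme2023, eq. (1)] -/
theorem sum_factorRates (k : ι → Pauli) (μ : ℝ) : ∑ S, factorRates k μ S = 1 := by
  unfold factorRates
  rw [Finset.sum_add_distrib, Finset.sum_ite_eq', Finset.sum_ite_eq']
  simp


/-! ### Composition of Pauli channels; the model is a valid Pauli channel for `λ ≥ 0` -/

omit [DecidableEq ι] in
/-- The phase of a product of Pauli strings is unimodular. [cite: vandenBergMinevKandalaTemme2023, SI §SIII (the computation "(P⊗Pᵀ)(Q⊗Qᵀ) = ((±PQ)⊗(±(PQ)ᵀ))")] -/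
theorem star_stringPhase_mul (a b : ι → Pauli) :
    star (stringPhase a b) * stringPhase a b = 1 := by
  classical
  have hU : (pauliString a * pauliString b) * (pauliString a * pauliString b)ᴴ = 1 := by
    rw [Matrix.conjTranspose_mul, conjTranspose_pauliString, conjTranspose_pauliString,
      Matrix.mul_assoc, ← Matrix.mul_assoc (pauliString b), pauliString_mul_self, Matrix.one_mul,
      pauliString_mul_self]
  rw [pauliString_mul, Matrix.conjTranspose_smul, conjTranspose_pauliString, Matrix.smul_mul,
    Matrix.mul_smul, pauliString_mul_self, smul_smul] at hU
  have htr := congrArg Matrix.trace hU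
  rw [Matrix.trace_smul, Matrix.trace_one, Fintype.card_fun, Fintype.card_bool, smul_eq_mul] at htr
  have hne : ((2 ^ Fintype.card ι : ℕ) : ℂ) ≠ 0 := by exact_mod_cast pow_ne_zero _ two_ne_zero
  have := mul_right_cancel₀ hne (htr.trans (one_mul _).symm)
  rwa [mul_comm] at this

/-- `(P_a P_b) ρ (P_b P_a) = P_{ab} ρ P_{ab}` — the phases `±1, ±i` of `P_a P_b = φ P_{ab}` cancel in a
sandwich. [cite: vandenBergMinevKandalaTemme2023, SI §SIII ("((±PQ)⊗(±(PQ)ᵀ))")] -/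
theorem sandwich_mul_eq (a b : ι → Pauli) (ρ : Matrix (ι → Bool) (ι → Bool) ℂ) :
    pauliString a * pauliString b * ρ * (pauliString b * pauliString a) =
      pauliString (stringMul a b) * ρ * pauliString (stringMul a b) := by
  have hba : pauliString b * pauliString a = (pauliString a * pauliString b)ᴴ := by
    rw [Matrix.conjTranspose_mul, conjTranspose_pauliString, conjTranspose_pauliString]
  rw [hba, pauliString_mul, Matrix.conjTranspose_smul, conjTranspose_pauliString, Matrix.smul_mul,
    Matrix.smul_mul, Matrix.mul_smul, smul_smul, mul_comm (stringPhase a b), star_stringPhase_mul,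
    one_smul]

/-- Composition of Pauli conjugations is conjugation by the product string. [cite: vandenBergMinevKandalaTemme2023, SI §SIII] -/
theorem conjBy_conjBy_eq (a b : ι → Pauli) (ρ : Matrix (ι → Bool) (ι → Bool) ℂ) :
    conjBy a (conjBy b ρ) = conjBy (stringMul a b) ρ := by
  unfold conjBy
  rw [← sandwich_mul_eq]; simp only [Matrix.mul_assoc]

/-- The error rates of a composite of two Pauli channels: the convolution
`r_c = Σ_{a·b = c} p_a q_b` over the Pauli group modulo phases.
[cite: vandenBergMinevKandalaTemme2023, SI §SIII ("expresses the fact that Pauli channels commute") and §SIII A ("successive Pauli channels")] -/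
def convRates (p q : (ι → Pauli) → ℂ) (c : ι → Pauli) : ℂ :=
  ∑ a, ∑ b, if stringMul a b = c then p a * q b else 0

/-- **A composite of Pauli channels is the Pauli channel with the convolved rates**:
`Λ_p ∘ Λ_q = Λ_{p⋆q}`. [cite: vandenBergMinevKandalaTemme2023, SI §SIII A ("successive Pauli channels") and §SIII ("Pauli channels commute")] -/
theorem pauliChannel_comp (p q : (ι → Pauli) → ℂ) (ρ : Matrix (ι → Bool) (ι → Bool) ℂ) :
    pauliChannel p (pauliChannel q ρ) = pauliChannel (convRates p q) ρ := by
  have lhs : pauliChannel p (pauliChannel q ρ) =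
      ∑ a, ∑ b, (p a * q b) • conjBy (stringMul a b) ρ := by
    rw [pauliChannel_eq]
    refine Finset.sum_congr rfl fun a _ => ?_
    rw [pauliChannel_eq, Finset.mul_sum, Finset.sum_mul, Finset.smul_sum]
    refine Finset.sum_congr rfl fun b _ => ?_
    rw [Matrix.mul_smul, Matrix.smul_mul, smul_smul, ← conjBy_conjBy_eq]
    unfold conjBy; simp only [Matrix.mul_assoc]
  have rhs : pauliChannel (convRates p q) ρ =
      ∑ a, ∑ b, (p a * q b) • conjBy (stringMul a b) ρ := by
    rw [pauliChannel_eq]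
    unfold convRates
    simp only [Finset.sum_smul, ite_smul, zero_smul]
    rw [Finset.sum_comm]
    refine Finset.sum_congr rfl fun a _ => ?_
    rw [Finset.sum_comm]
    refine Finset.sum_congr rfl fun b _ => ?_
    rw [Finset.sum_ite_eq, if_pos (Finset.mem_univ _)]
    unfold conjBy; rfl
  rw [lhs, rhs]

/-- Convolution multiplies total masses: `Σ_c (p⋆q)_c = (Σ p)(Σ q)`. [cite: vandenBergMinevKandalaTemme2023, SI §SIII A] -/
theorem sum_convRates (p q : (ι → Pauli) → ℂ) : ∑ c, convRates p q c = (∑ a, p a) * ∑ b, q b := by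
  unfold convRates
  rw [Finset.sum_comm, Finset.sum_mul_sum]
  refine Finset.sum_congr rfl fun a _ => ?_
  rw [Finset.sum_comm]
  refine Finset.sum_congr rfl fun b _ => ?_
  rw [Finset.sum_ite_eq, if_pos (Finset.mem_univ _)]

/-- Convolution preserves nonnegativity. [cite: vandenBergMinevKandalaTemme2023, SI §SIII A] -/
theorem convRates_nonneg {p q : (ι → Pauli) → ℝ} (hp : ∀ a, 0 ≤ p a) (hq : ∀ b, 0 ≤ q b)
    (c : ι → Pauli) :
    0 ≤ ∑ a, ∑ b, (if stringMul a b = c then p a * q b else 0) :=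
  Finset.sum_nonneg fun a _ => Finset.sum_nonneg fun b _ => by
    split_ifs
    · exact mul_nonneg (hp a) (hq b)
    · exact le_rfl

/-- The Pauli error rates of the channel of a list (iterated convolution of the factors' rates).
[cite: vandenBergMinevKandalaTemme2023, SI eq. (S9) ("(S9) is a valid Pauli channel for all λ ≥ 0")] -/
def rates : List ((ι → Pauli) × ℝ) → (ι → Pauli) → ℝ
  | [] => fun S => if S = fun _ => Pauli.I then 1 else 0
  | kμ :: L => fun c => ∑ a, ∑ b, if stringMul a b = c then factorRates kμ.1 kμ.2 a * rates L b else 0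

/-- Unfolding (empty model: all mass on the identity). [cite: vandenBergMinevKandalaTemme2023, eq. (1)] -/
theorem rates_nil : rates ([] : List ((ι → Pauli) × ℝ)) = fun S => if S = fun _ => Pauli.I then 1 else 0 :=
  rfl

/-- Unfolding (one more factor: convolve with its two-point rates). [cite: vandenBergMinevKandalaTemme2023, eq. (1)] -/
theorem rates_cons (kμ : (ι → Pauli) × ℝ) (L : List ((ι → Pauli) × ℝ)) :
    rates (kμ :: L) =
      fun c => ∑ a, ∑ b, if stringMul a b = c then factorRates kμ.1 kμ.2 a * rates L b else 0 :=
  rfl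

/-- **"(S9) is a valid Pauli channel"**, part 1: the model IS a Pauli channel, `Λ_L = Σ_S r_L(S) P_S · P_S`,
with the explicit rates `rates L`. [cite: vandenBergMinevKandalaTemme2023, SI §SIII (sentence after (S11))] -/
theorem channel_eq_pauliChannel (L : List ((ι → Pauli) × ℝ)) (ρ : Matrix (ι → Bool) (ι → Bool) ℂ) :
    channel L ρ = pauliChannel (fun S => ((rates L S : ℝ) : ℂ)) ρ := by
  induction L generalizing ρ with
  | nil =>
    rw [channel_nil, pauliChannel_eq, rates_nil]
    simp only [apply_ite Complex.ofReal, Complex.ofReal_one, Complex.ofReal_zero, ite_smul, one_smul,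
      zero_smul, Finset.sum_ite_eq', Finset.mem_univ, if_true, pauliString_const_I, Matrix.one_mul,
      Matrix.mul_one]
  | cons kμ L ih =>
    rw [show channel (kμ :: L) ρ = factor kμ.1 kμ.2 (channel L ρ) from rfl, ih, factor_eq_pauliChannel,
      pauliChannel_comp, rates_cons]
    congr 1
    funext c
    unfold convRates
    push_cast
    refine Finset.sum_congr rfl fun a _ => Finset.sum_congr rfl fun b _ => ?_
    split_ifs <;> simp

/-- **"(S9) is a valid Pauli channel for all λ ≥ 0"**, part 2: its rates are nonnegative when every
`λ_k ≥ 0`. [cite: vandenBergMinevKandalaTemme2023, SI §SIII (sentence after (S11))] -/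
theorem rates_nonneg {L : List ((ι → Pauli) × ℝ)} (hL : ∀ kμ ∈ L, 0 ≤ kμ.2) (S : ι → Pauli) :
    0 ≤ rates L S := by
  induction L generalizing S with
  | nil => rw [rates_nil]; dsimp only; split_ifs <;> norm_num
  | cons kμ L ih =>
    rw [rates_cons]
    exact convRates_nonneg (factorRates_nonneg kμ.1 (hL kμ List.mem_cons_self))
      (fun b => ih (fun x hx => hL x (List.mem_cons_of_mem _ hx)) b) S

/-- … part 3: and they sum to `1` (trace preservation). [cite: vandenBergMinevKandalaTemme2023, SI §SIII (sentence after (S11))] -/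
theorem sum_rates (L : List ((ι → Pauli) × ℝ)) : ∑ S, rates L S = 1 := by
  induction L with
  | nil => rw [rates_nil]; dsimp only; rw [Finset.sum_ite_eq']; simp
  | cons kμ L ih =>
    rw [rates_cons]; dsimp only
    rw [Finset.sum_comm, Finset.sum_congr rfl fun a _ => Finset.sum_comm, ← ih, ← one_mul (∑ S, rates L S),
      ← sum_factorRates kμ.1 kμ.2, Finset.sum_mul_sum]
    refine Finset.sum_congr rfl fun a _ => Finset.sum_congr rfl fun b _ => ?_
    rw [Finset.sum_ite_eq, if_pos (Finset.mem_univ _)]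

end Literature.InformationTheory.QuantumLearning.SparsePauliLindblad
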